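import Summits.QuantumFields.YangMills.Theorems.BalabanUVNodesN18RunDifferenceOfLocalTermsRecord
import Literature.MathematicalPhysics.QuantumFieldTheory.Balaban1983to89.Node00.Record8Inhabited

/-!
# BalabanUVNodes ∕ N18 (node U3's kernel objects) — THE (1.21) EXISTENCE LETTER FROM THE LOCALIZED REPRESENTATION (1.7): «This limit exists by the localized representation (1.7)»
# ([I] p. 264) as a theorem schema — a localized sum whose R-TRUNCATED window sums converge as the volume grows (volume independence of the small-domain (2.13) terms) and whose
# terms obey K-uniform soft VALUE majorants has convergent (1.21) windows: W1-19b's `PolLimitsExist F (localizedSum F S emb) ρ bV W`, and OF RECORD `PolLimitsExistOfRecord₁₃ F N θ`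
# under W1-20's law (Track A, DAG node N18 = NE5 ∕ node U3's shared existence letter; key K3⁸ `SpineGivenEndpointR13SepCoPHV` = stmt-QuantumFields-27366; cell `pub-ymgap`, WIDTH SEAT
# `pub-ymgap-dag-n18-w2` g9, FILE 5; `--kind proof --supports stmt-QuantumFields-27366 --as helper`, COUNT-NEUTRAL; THEOREMS ONLY, 0 `def`, 0 `sorry`)

WHY.  Every termwise road to node U3's three kernel letters — (D4) `KernelDecay` (dag-n22-w2 `windowedDecay_localizedSum_of_softSum` + dag-n27-w1), N22 `NE9` (dag-n22-w2∕-w3),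
N18 `KernelStepRate` (this seat's PART 1–4) — passes from WINDOWED finite-volume bounds to the LIMITING (1.21) kernels through the existence letter `PolLimitsExist(OfRecord₁₃)`
([I] (1.21) p. 264 «Now we take a limit of these functions as T^{(j+1)} ↗ Z^d»), displayed as a hypothesis by all of them; its only producer road in the tree is W1-21's
`GeometricIncrements` (dag-n22-w3 `polLimitExists_of_eventually_geometric_increments`, this seat's g6 `…N18PolLimitRateOfGeometricIncrements`), itself without a producer
(plan START-LIST v11 §n18: «W1-21's letter … has NO consumer∕producer in the tree today»).  Print's own reason is the next sentence of p. 264: «This limit exists by the localized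
representation (1.7)»: at fixed separation `z` the window `Π^{(K)}_{k+1}(z)` is the sum over the localization domains `X` of the terms' kernels; the terms with `d(X) ≤ R` near the
window sites are eventually THE SAME local objects in every volume (locality of the cluster expansion, [II] (2.13)–(2.14); through the minimizer of p. 264 only up to tails, so: their
sum CONVERGES as `K → ∞`), and the terms with `d(X) > R` contribute `≤ C e^{−κR∕2}` uniformly in `K` by the (5.10) soft majorants and the tree leaf.  Hence the windows are, for every
`ε`, eventually `ε`-close to a convergent sequence — so they converge (ℝ is complete).  THIS FILE types exactly that, with dag-n22-w2's (5.10) leaves discharged on def-T's catalogue.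

WHAT.
* §1 (real analysis) `exists_tendsto_of_forall_eventually_near_tendsto` (a real sequence that is, for every `ε > 0`, eventually `ε`-close to SOME convergent sequence converges).
* §2 (one torus `T^{(k+1)}_K`, any finite catalogue; def-B's scalar kernel): `polScalar_sum_eq_truncated_add_tail` (the window of a localized sum = the `R`-truncated sum of the
  terms' kernels + the kernel of the tail functional `Σ_{d(X) > R} ℰ X`, J27's `polScalar_finset_sum` twice) · `abs_polScalar_tail_le_sum_indicator` (J27's value twin
  `abs_polScalar_sum_le_twoPointSum` at `supp := univ`: the tail kernel is bounded by `Σ_X 𝟙[R < d(X)]·b(X)` under per-term colour-diagonal bounds `b`).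
* §3 (W1-20's `localizedSum F S emb` on def-T's catalogue of record, `M = L^{m′}`, leaves DISCHARGED): ★★ `eventually_abs_polWindow_sub_truncated_le` — K-uniform soft VALUE
  majorants `C_E e^{−κ d(X)} e^{−δ₀ distCT(cast site z, X)} e^{−δ₀ distCT(cast site 0, X)}` (the (D4) road's own windowed input, [I] (1.18) + (4.35)–(4.37) pp. 290–291) ⇒ for every `R`,
  `∀ᶠ K, |Π^{(K)}_{k+1}(z) − S_R(K)| ≤ C_E e^{12Mδ₁}K₀(64,8)K₁(4,δ₀∕2)·e^{−κR∕2}·e^{−δ₁|z|₁}`, `δ₁ = ½min{δ₀, (κ∕2)(4M)⁻¹}` (dag-n22-w2's `eventually_le_of_softSum_domSys` at rate `κ∕2`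
  with weight `e^{−κR∕2}`: a term with `d(X) > R` has `e^{−κd} ≤ e^{−κR∕2}e^{−κd∕2}`).
* §4 THE LETTER: ★★★ `polLimitExists_localizedSum_of_truncationStable` (per `(k, hist)`: soft value majorants + «the `R`-truncated window sums converge in `K` for every `R`» ⇒
  `PolLimitExists F (k+1) (fun K => localizedSum F S emb k hist K) ρ bV`) · ★★★ `polLimitsExist_localizedSum_of_truncationStable` (⇒ W1-19b's `PolLimitsExist … W`) ·
  ★★★ `polLimitsExistOfRecord₁₃_of_truncationStable` (under `Localizes17OfRecord₁₃ F N θ S emb` ⇒ `PolLimitsExistOfRecord₁₃ F N θ`, def-W1's `polLimitsExistOfRecord₁₃_iff_of_localizes`).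
* §5 A6 smoke: `polLimitsExist_localizedSum_of_truncationStable_fires_zeroChart` (at `ρ = 0` every kernel and every truncated sum vanish; the hypotheses hold with `C_E := 0`).

HONEST FRAMING — what this is NOT.  Count-neutral bookkeeping (J27's additivity, dag-n22-w2's (5.10) resummation on the catalogue of record, completeness of ℝ); NO estimate of
Bałaban's is proved or asserted — the soft VALUE majorants ((1.18) + the tails of p. 282 ∕ (4.35)–(4.37) pp. 290–291, NODE A ∕ NODE O content) and the TRUNCATION STABILITY «the `R`-truncated window sums converge as
`T^{(k+1)} ↗ ℤ⁴`» (the volume independence of the cluster expansion's local terms [II] read through the minimizer of [I] p. 264 — the CONTENT of p. 264's sentence, NODE A ∕ N10) are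
DISPLAYED hypotheses; nothing of the (2.13) terms constructed; no letter OF RECORD inhabited; N18 ∕ N22 ∕ (D4) NOT discharged; K3⁸ OPEN (v6 b4e55110ab73e679), not claimed; counts
UNMOVED (typed 28∕28 · discharged 5∕27 (A 5∕28)); one finite four-torus programme at fixed ε, Bałaban AS PRINTED; R4 closes the conditional finite-𝕋⁴ rung `BalabanLadder.UV` only — NOT
ℝ⁴, NOT infinite volume, NOT OS, NOT a mass gap; the Clay problem is NOT proved by any of this.

References (TYPES only): [I] = [Balaban1987RG1] (1.7) p. 261, (1.18) p. 263, (1.20)–(1.21) p. 264, p. 282 (the exponential-tail remark), (4.35)–(4.36) p. 290 and (4.37) p. 291, (5.10) p. 293; [II] = [Balaban1988RG2Cluster] (2.13)–(2.14) pp. 14–15.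
Imports PART 2 of this seat's road (through it dag-n22-w2's `…N22WindowSoftTwoPointDomSys`, dag-n22-c's J27, def-W1's `U3KernelLetters ∕ LocalizedSum17`) and dag-n23-b's
`Node00/Record8Inhabited` (`polTensor_const ∕ polWindow_zeroChart`) BY NAME; nothing re-declared.
-/

noncomputable section

namespace YMDAG.N18.PolLimitsExistOfLocalTerms

open Filter Metric
open scoped BigOperators Topology
open Literature.MathematicalPhysics.QuantumFieldTheory.Balaban1983to89
open Literature.MathematicalPhysics.QuantumFieldTheory.Balaban1983to89.T4Continuum (T4Family)
open Literature.MathematicalPhysics.QuantumFieldTheory.Balaban1983to89.B12Sec2to5 (l1)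
open Literature.MathematicalPhysics.QuantumFieldTheory.Balaban1983to89.B12PolarizationTensor120 (polComp expChart)
open Literature.MathematicalPhysics.QuantumFieldTheory.Balaban1983to89.Node00 (Stage13Params PolLimitExists polScalar polWindow siteOfInt MatA)
open Literature.MathematicalPhysics.QuantumFieldTheory.Balaban1983to89.Node00.U3OfKernels (histPrefix)
open Literature.MathematicalPhysics.QuantumFieldTheory.Balaban1983to89.Node00.U3KernelLetters (PolLimitsExist PolLimitsExistOfRecord₁₃ polLimitsExistOfRecord₁₃_iff_of_localizes)
open Literature.MathematicalPhysics.QuantumFieldTheory.Balaban1983to89.Node00.LocalizedSum17 (localizedSum ReadingMaps Localizes17OfRecord₁₃)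
open Literature.MathematicalPhysics.QuantumFieldTheory.Balaban1983to89.Node00.Sect2 (domSys domCount)
open Literature.MathematicalPhysics.QuantumFieldTheory.Balaban1983to89.Node00.W1 (ClusterTower)
open Literature.MathematicalPhysics.QuantumFieldTheory.Balaban1983to89.Node00.Record8Inhabited (polTensor_const expChart_zeroChart polScalar_zeroChart)
open Literature.MathematicalPhysics.QuantumFieldTheory.Balaban1983to89.T4OutputRate (Window)
open Literature.MathematicalPhysics.QuantumFieldTheory.Balaban1983to89.B12Decay510 (delta1)
open Literature.MathematicalPhysics.QuantumFieldTheory.Balaban1983to89.B12Decay510Window (K₁)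
open Literature.MathematicalPhysics.QuantumFieldTheory.Balaban1983to89.B12Decay510Torus (distCT nearT)
open Literature.MathematicalPhysics.QuantumFieldTheory.Balaban1983to89.B12TreeDecay (K₀ kappa₀)
open Literature.MathematicalPhysics.QuantumFieldTheory.Balaban1983to89.TreeLengthTorus (TPt torusTreeLen)
open YMDAG.N22.WindowOfLocalTerms (polScalar_finset_sum abs_polScalar_sum_le_twoPointSum)
open YMDAG.N22.WindowSoftTwoPoint (eventually_le_of_softSum_domSys)

/-! ## §1 Real analysis: a sequence eventually `ε`-close to convergent sequences, for every `ε`, converges -/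

/-- **A REAL SEQUENCE THAT IS, FOR EVERY `ε > 0`, EVENTUALLY `ε`-CLOSE TO SOME CONVERGENT SEQUENCE, CONVERGES** (it is Cauchy; ℝ is complete).  The scheme of [I] p. 264 «This limit
exists by the localized representation (1.7)»: the convergent sequences are the truncated sums, `ε` the tail. [cite: Balaban1987RG1, (1.21) p.264] -/
theorem exists_tendsto_of_forall_eventually_near_tendsto (u : ℕ → ℝ)
    (h : ∀ ε > 0, ∃ (c : ℕ → ℝ) (s : ℝ), Tendsto c atTop (𝓝 s) ∧ ∀ᶠ K in atTop, |u K - c K| ≤ ε) : ∃ P : ℝ, Tendsto u atTop (𝓝 P) := by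
  refine cauchySeq_tendsto_of_complete (Metric.cauchySeq_iff'.2 fun ε hε => ?_)
  obtain ⟨c, s, hc, hclose⟩ := h (ε / 4) (by positivity)
  have hc' : ∀ᶠ K in atTop, |c K - s| < ε / 4 := by
    have := (Metric.tendsto_atTop.1 hc) (ε / 4) (by positivity)
    obtain ⟨N, hN⟩ := this
    exact eventually_atTop.2 ⟨N, fun K hK => by simpa [Real.dist_eq] using hN K hK⟩
  obtain ⟨N, hN⟩ := eventually_atTop.1 (hclose.and hc')
  refine ⟨N, fun n hn => ?_⟩
  have h1 := hN n hn
  have h2 := hN N le_rfl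
  rw [Real.dist_eq]
  have : |u n - u N| ≤ |u n - c n| + |c n - s| + (|u N - c N| + |c N - s|) := by
    calc |u n - u N| = |(u n - c n) + (c n - s) - ((u N - c N) + (c N - s))| := by ring_nf
      _ ≤ |(u n - c n) + (c n - s)| + |(u N - c N) + (c N - s)| := abs_sub _ _
      _ ≤ |u n - c n| + |c n - s| + (|u N - c N| + |c N - s|) := add_le_add (abs_add_le _ _) (abs_add_le _ _)
  linarith [h1.1, h1.2, h2.1, h2.2]

/-! ## §2 One torus: the window of a localized sum = the `R`-truncated sum + the tail functional's kernel; the tail under per-term bounds -/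

section OneTorus

variable {𝔄 : Type*} [NormedRing 𝔄] [NormedAlgebra ℝ 𝔄] {V : Type*} [NormedAddCommGroup V] [NormedSpace ℝ V] {ι : Type*} [Fintype ι]
  {Λ T : Type*} [Fintype Λ] [Fintype T] [DecidableEq Λ] [DecidableEq T] {𝒳 : Type*} [Fintype 𝒳]

/-- **THE SCALAR KERNEL OF A LOCALIZED SUM = THE TRUNCATED SUM OF THE TERMS' KERNELS + THE KERNEL OF THE TAIL FUNCTIONAL** (J27's `polScalar_finset_sum` over `univ` and over the
tail filter; every term's chart `C²` at `0`; `p` any decidable predicate — of record `R < d(X)`). [cite: Balaban1987RG1, (1.7) p.261 and (1.20)-(1.21) p.264] -/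
theorem polScalar_sum_eq_truncated_add_tail (ℰ : 𝒳 → (Λ → T → 𝔄) → ℝ) (ρ : V →L[ℝ] 𝔄) (bV : Module.Basis ι ℝ V)
    (hℰ : ∀ X, ContDiffAt ℝ 2 (expChart (ℰ X) ρ) 0) (p : 𝒳 → Prop) [DecidablePred p] (μ : Λ) (x : T) (ν : Λ) (y : T) :
    polScalar (fun U => ∑ X, ℰ X U) ρ bV μ x ν y =
      (∑ X ∈ Finset.univ.filter (fun X => ¬ p X), polScalar (ℰ X) ρ bV μ x ν y) +
        polScalar (fun U => ∑ X ∈ Finset.univ.filter p, ℰ X U) ρ bV μ x ν y := by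
  rw [polScalar_finset_sum Finset.univ ℰ ρ bV (fun X _ => hℰ X), polScalar_finset_sum _ ℰ ρ bV (fun X _ => hℰ X),
    ← Finset.sum_filter_add_sum_filter_not Finset.univ p, add_comm]

/-- **THE TAIL KERNEL UNDER PER-TERM COLOUR-DIAGONAL BOUNDS** (J27's value twin at `supp := univ`): if every tail term's colour-diagonal kernel at `(x, y)` is `≤ b(X)` (`b ≥ 0`), then
`|Π[Σ_{p X} ℰ X](x, y)| ≤ Σ_X 𝟙[p X]·b(X)`. [cite: Balaban1987RG1, (1.7) p.261, (1.18) p.263 and (1.20)-(1.21) p.264] -/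
theorem abs_polScalar_tail_le_sum_indicator (ℰ : 𝒳 → (Λ → T → 𝔄) → ℝ) (ρ : V →L[ℝ] 𝔄) (bV : Module.Basis ι ℝ V)
    (hℰ : ∀ X, ContDiffAt ℝ 2 (expChart (ℰ X) ρ) 0) (p : 𝒳 → Prop) [DecidablePred p] (b : 𝒳 → ℝ) (hb : ∀ X, 0 ≤ b X) (μ : Λ) (x : T) (ν : Λ) (y : T)
    (hterm : ∀ X, p X → ∀ c : ι, |polComp ℝ (expChart (ℰ X) ρ) bV μ x c ν y c| ≤ b X) :
    |polScalar (fun U => ∑ X ∈ Finset.univ.filter p, ℰ X U) ρ bV μ x ν y| ≤ ∑ X, if p X then b X else 0 := by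
  classical
  have h := abs_polScalar_sum_le_twoPointSum (Finset.univ.filter p) ℰ ρ bV (fun X _ => hℰ X) (fun _ => (Set.univ : Set T)) b
    (fun X _ => hb X) μ x ν y (fun X hX c => by
      rw [if_pos (show x ∈ (Set.univ : Set T) ∧ y ∈ (Set.univ : Set T) from ⟨Set.mem_univ _, Set.mem_univ _⟩)]
      exact hterm X (Finset.mem_filter.1 hX).2 c)
  rw [Finset.filter_true_of_mem (fun X _ => (⟨Set.mem_univ _, Set.mem_univ _⟩ : x ∈ (Set.univ : Set T) ∧ y ∈ (Set.univ : Set T))),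
    Finset.sum_filter] at h
  exact h

end OneTorus

/-! ## §3 The truncation tail of W1-20's localized sum on def-T's catalogue of record, eventually in `K`, leaves DISCHARGED -/

section Tail

variable {𝔄 : Type*} [NormedRing 𝔄] [NormedAlgebra ℝ 𝔄] {V : Type*} [NormedAddCommGroup V] [NormedSpace ℝ V] {ι : Type*} [Fintype ι] {𝔸 : Type*}
variable (F : T4Family) (m' : ℕ) (M : ℕ) [NeZero M] (hM : M = F.L ^ m')
variable (S : (K : ℕ) → ClusterTower (F.P K) 𝔸 M) (emb : ReadingMaps F 𝔄 𝔸) (ρ : V →L[ℝ] 𝔄) (bV : Module.Basis ι ℝ V)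

include hM in
open Classical in
/-- ★★ **THE WINDOW MINUS ITS `R`-TRUNCATION IS EVENTUALLY SMALL, UNIFORMLY: `|Π^{(K)}_{k+1}(z) − S_R(K)| ≤ C·e^{−κR∕2}·e^{−δ₁|z|₁}` for all large `K`** (one level `k`, one
history `hist`, one kernel entry, `M = L^{m′}`).  Here `S_R(K) := Σ_{X ∈ 𝐃_{k+1}(T_K), d(X) ≤ R} Π[Re E^{(k+1)}_K(X; hist; ·)](site z, site 0)` is the truncated sum of the terms'
scalar kernels; the hypotheses are the terms' `C²` charts and the K-uniform soft VALUE majorants of the (D4) road (`C_E e^{−κ d(X)}e^{−δ₀ distCT(cast site z, X)}e^{−δ₀ distCT(cast site 0, X)}`,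
`δ₀ > 0`, `κ∕4 ≥ κ₀(64,8)`, `κ ≥ 0`); `C = C_E e^{12Mδ₁} K₀(64,8) K₁(4,δ₀∕2)` with `δ₁ = ½min{δ₀, (κ∕2)(4M)⁻¹}` — dag-n22-w2's `eventually_le_of_softSum_domSys` at rate `κ∕2`
and weight `e^{−κR∕2}` (a term with `d(X) > R` has `e^{−κ d} ≤ e^{−κR∕2}·e^{−(κ∕2) d}`). [cite: Balaban1987RG1, (1.7) p.261, (1.18) p.263, (1.20)-(1.21) p.264 and (5.10) p.293] -/
theorem eventually_abs_polWindow_sub_truncated_le (k : ℕ) (hist : Fin (k + 1) → ℝ) (μ ν : Fin 4) (z : Fin 4 → ℤ) (R : ℝ)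
    (hC : ∀ (K : ℕ) (X : (domSys (F.P K) M (k + 1)).Dom), ContDiffAt ℝ 2 (expChart (fun W => (((S K) k).E hist (emb K k W) X).re) ρ) 0)
    {CE κ δ₀ : ℝ} (hCE : 0 ≤ CE) (hκ0 : 0 ≤ κ) (hδ₀ : 0 < δ₀) (hκ : kappa₀ (4 * 2 ^ 4) (2 * 4) ≤ κ / 2 / 2)
    (hval : ∀ (K : ℕ) (X : (domSys (F.P K) M (k + 1)).Dom) (c : ι),
      let e : Site (F.P K) (k + 1) → TPt 4 (domCount (F.P K) M (k + 1) * M) := fun x i => (ZMod.cast (x i) : ZMod (domCount (F.P K) M (k + 1) * M))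
      |polComp ℝ (expChart (fun W => (((S K) k).E hist (emb K k W) X).re) ρ) bV (Fin.cast (F.P_d K).symm μ) (siteOfInt F K (k + 1) z) c
          (Fin.cast (F.P_d K).symm ν) (siteOfInt F K (k + 1) 0) c| ≤
        CE * Real.exp (-κ * torusTreeLen X.1) * Real.exp (-δ₀ * distCT (domCount (F.P K) M (k + 1)) M (e (siteOfInt F K (k + 1) z)) (nearT (M := M) (e (siteOfInt F K (k + 1) z)) X)) *
          Real.exp (-δ₀ * distCT (domCount (F.P K) M (k + 1)) M (e (siteOfInt F K (k + 1) 0)) (nearT (M := M) (e (siteOfInt F K (k + 1) 0)) X))) :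
    ∀ᶠ K in atTop,
      |polWindow F K (k + 1) (localizedSum F S emb k hist K) ρ bV μ ν z -
          ∑ X ∈ Finset.univ.filter (fun X : (domSys (F.P K) M (k + 1)).Dom => ¬ R < torusTreeLen X.1),
            polScalar (fun W => (((S K) k).E hist (emb K k W) X).re) ρ bV (Fin.cast (F.P_d K).symm μ) (siteOfInt F K (k + 1) z) (Fin.cast (F.P_d K).symm ν)
              (siteOfInt F K (k + 1) 0)| ≤
        CE * Real.exp (delta1 δ₀ (κ / 2) ((M : ℝ) * 4) * ((M : ℝ) * 4) * 3) * K₀ (4 * 2 ^ 4) (2 * 4) * K₁ 4 (δ₀ / 2) * Real.exp (-(κ / 2) * R) *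
          Real.exp (-(delta1 δ₀ (κ / 2) ((M : ℝ) * 4) * l1 z)) := by
  -- per-`K` Σ-shape: the window minus the truncated sum IS the tail functional's kernel (§2), bounded termwise by the indicator-weighted majorants
  have hΔ : ∀ K, |polWindow F K (k + 1) (localizedSum F S emb k hist K) ρ bV μ ν z -
      ∑ X ∈ Finset.univ.filter (fun X : (domSys (F.P K) M (k + 1)).Dom => ¬ R < torusTreeLen X.1),
        polScalar (fun W => (((S K) k).E hist (emb K k W) X).re) ρ bV (Fin.cast (F.P_d K).symm μ) (siteOfInt F K (k + 1) z) (Fin.cast (F.P_d K).symm ν)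
          (siteOfInt F K (k + 1) 0)| ≤
      ∑ X : (domSys (F.P K) M (k + 1)).Dom, (if R < torusTreeLen X.1 then
        CE * Real.exp (-κ * torusTreeLen X.1) *
          Real.exp (-δ₀ * distCT (domCount (F.P K) M (k + 1)) M (fun i : Fin 4 => (ZMod.cast (siteOfInt F K (k + 1) z i) : ZMod (domCount (F.P K) M (k + 1) * M)))
            (nearT (M := M) (fun i : Fin 4 => (ZMod.cast (siteOfInt F K (k + 1) z i) : ZMod (domCount (F.P K) M (k + 1) * M))) X)) *
          Real.exp (-δ₀ * distCT (domCount (F.P K) M (k + 1)) M (fun i : Fin 4 => (ZMod.cast (siteOfInt F K (k + 1) 0 i) : ZMod (domCount (F.P K) M (k + 1) * M)))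
            (nearT (M := M) (fun i : Fin 4 => (ZMod.cast (siteOfInt F K (k + 1) 0 i) : ZMod (domCount (F.P K) M (k + 1) * M))) X)) else 0) := by
    intro K
    have e1 : polWindow F K (k + 1) (localizedSum F S emb k hist K) ρ bV μ ν z =
        polScalar (fun U => ∑ X : (domSys (F.P K) M (k + 1)).Dom, (fun X W => (((S K) k).E hist (emb K k W) X).re) X U) ρ bV (Fin.cast (F.P_d K).symm μ)
          (siteOfInt F K (k + 1) z) (Fin.cast (F.P_d K).symm ν) (siteOfInt F K (k + 1) 0) := rfl
    rw [e1, polScalar_sum_eq_truncated_add_tail _ ρ bV (hC K) (fun X => R < torusTreeLen X.1), add_sub_cancel_left]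
    exact abs_polScalar_tail_le_sum_indicator _ ρ bV (hC K) (fun X => R < torusTreeLen X.1) _
      (fun X => mul_nonneg (mul_nonneg (mul_nonneg hCE (Real.exp_pos _).le) (Real.exp_pos _).le) (Real.exp_pos _).le) _ _ _ _ (fun X _ c => hval K X c)
  -- the indicator-weighted majorant is a soft majorant at rate `κ∕2` with weight `e^{−κR∕2}`
  have h := eventually_le_of_softSum_domSys F (k + 1) m' M hM _ _ hCE (Real.exp_pos (-(κ / 2) * R)).le hδ₀ hκ z hΔ (fun K X => ?_)
  · exact h
  · dsimp only
    split_ifs with hR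
    · have hsplit : Real.exp (-κ * torusTreeLen X.1) ≤ Real.exp (-(κ / 2) * R) * Real.exp (-(κ / 2) * torusTreeLen X.1) := by
        rw [← Real.exp_add]
        exact Real.exp_le_exp.2 (by nlinarith)
      exact (mul_le_mul_of_nonneg_right (mul_le_mul_of_nonneg_right (mul_le_mul_of_nonneg_left hsplit hCE) (Real.exp_pos _).le)
        (Real.exp_pos _).le).trans_eq (by ring)
    · exact mul_nonneg (mul_nonneg (mul_nonneg (mul_nonneg hCE (Real.exp_pos _).le) (Real.exp_pos _).le) (Real.exp_pos _).le) (Real.exp_pos _).le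

end Tail

/-! ## §4 THE (1.21) EXISTENCE LETTER from truncation stability + soft value majorants -/

section Letter

variable {𝔄 : Type*} [NormedRing 𝔄] [NormedAlgebra ℝ 𝔄] {V : Type*} [NormedAddCommGroup V] [NormedSpace ℝ V] {ι : Type*} [Fintype ι] {𝔸 : Type*}
variable (F : T4Family) (m' : ℕ) (M : ℕ) [NeZero M] (hM : M = F.L ^ m')
variable (S : (K : ℕ) → ClusterTower (F.P K) 𝔸 M) (emb : ReadingMaps F 𝔄 𝔸) (ρ : V →L[ℝ] 𝔄) (bV : Module.Basis ι ℝ V)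

include hM in
open Classical in
/-- ★★★ **«THIS LIMIT EXISTS BY THE LOCALIZED REPRESENTATION (1.7)»** ([I] p. 264), per level `k` and history `hist`: IF the (2.13) terms read in def-B's chart are `C²` at `0`,
obey K-uniform soft VALUE majorants (`C_E` may depend on the kernel entry; `δ₀ > 0`, `κ > 0`, `κ∕4 ≥ κ₀(64,8)`), and for every kernel entry `(μ, ν, z)` and every truncation radius
`R : ℕ` the `R`-TRUNCATED sum of the terms' kernels at the window sites CONVERGES as `K → ∞` (volume independence of the small-domain terms — DISPLAYED, NODE A ∕ N10 content),
THEN the (1.21) windows converge: `PolLimitExists F (k+1) (fun K => localizedSum F S emb k hist K) ρ bV`. [cite: Balaban1987RG1, (1.7) p.261 and (1.20)-(1.21) p.264; Balaban1988RG2Cluster, (2.13)-(2.14) pp.14-15] -/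
theorem polLimitExists_localizedSum_of_truncationStable (k : ℕ) (hist : Fin (k + 1) → ℝ)
    (hC : ∀ (K : ℕ) (X : (domSys (F.P K) M (k + 1)).Dom), ContDiffAt ℝ 2 (expChart (fun W => (((S K) k).E hist (emb K k W) X).re) ρ) 0)
    {κ δ₀ : ℝ} (hκ0 : 0 < κ) (hδ₀ : 0 < δ₀) (hκ : kappa₀ (4 * 2 ^ 4) (2 * 4) ≤ κ / 2 / 2)
    (hval : ∀ (μ ν : Fin 4) (z : Fin 4 → ℤ), ∃ CE : ℝ, 0 ≤ CE ∧ ∀ (K : ℕ) (X : (domSys (F.P K) M (k + 1)).Dom) (c : ι),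
      let e : Site (F.P K) (k + 1) → TPt 4 (domCount (F.P K) M (k + 1) * M) := fun x i => (ZMod.cast (x i) : ZMod (domCount (F.P K) M (k + 1) * M))
      |polComp ℝ (expChart (fun W => (((S K) k).E hist (emb K k W) X).re) ρ) bV (Fin.cast (F.P_d K).symm μ) (siteOfInt F K (k + 1) z) c
          (Fin.cast (F.P_d K).symm ν) (siteOfInt F K (k + 1) 0) c| ≤
        CE * Real.exp (-κ * torusTreeLen X.1) * Real.exp (-δ₀ * distCT (domCount (F.P K) M (k + 1)) M (e (siteOfInt F K (k + 1) z)) (nearT (M := M) (e (siteOfInt F K (k + 1) z)) X)) *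
          Real.exp (-δ₀ * distCT (domCount (F.P K) M (k + 1)) M (e (siteOfInt F K (k + 1) 0)) (nearT (M := M) (e (siteOfInt F K (k + 1) 0)) X)))
    (hstab : ∀ (μ ν : Fin 4) (z : Fin 4 → ℤ) (R : ℕ), ∃ s : ℝ, Tendsto (fun K : ℕ =>
      ∑ X ∈ Finset.univ.filter (fun X : (domSys (F.P K) M (k + 1)).Dom => ¬ (R : ℝ) < torusTreeLen X.1),
        polScalar (fun W => (((S K) k).E hist (emb K k W) X).re) ρ bV (Fin.cast (F.P_d K).symm μ) (siteOfInt F K (k + 1) z) (Fin.cast (F.P_d K).symm ν)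
          (siteOfInt F K (k + 1) 0)) atTop (𝓝 s)) :
    PolLimitExists F (k + 1) (fun K => localizedSum F S emb k hist K) ρ bV := by
  intro μ ν z
  obtain ⟨CE, hCE, hv⟩ := hval μ ν z
  refine exists_tendsto_of_forall_eventually_near_tendsto _ fun ε hε => ?_
  -- the tail constant and a truncation radius `R` making it `≤ ε`
  set Cst : ℝ := CE * Real.exp (delta1 δ₀ (κ / 2) ((M : ℝ) * 4) * ((M : ℝ) * 4) * 3) * K₀ (4 * 2 ^ 4) (2 * 4) * K₁ 4 (δ₀ / 2) *
    Real.exp (-(delta1 δ₀ (κ / 2) ((M : ℝ) * 4) * l1 z)) with hCst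
  have hlim : Tendsto (fun R : ℕ => Cst * Real.exp (-(κ / 2) * (R : ℝ))) atTop (𝓝 (Cst * 0)) := by
    refine tendsto_const_nhds.mul ?_
    have h1 : Tendsto (fun R : ℕ => -(κ / 2) * (R : ℝ)) atTop atBot :=
      (tendsto_natCast_atTop_atTop).const_mul_atTop_of_neg (by linarith)
    exact Real.tendsto_exp_atBot.comp h1
  rw [mul_zero] at hlim
  obtain ⟨R, hR⟩ := (Metric.tendsto_atTop.1 hlim ε hε)
  have hRε : Cst * Real.exp (-(κ / 2) * (R : ℝ)) ≤ ε := by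
    have := hR R le_rfl
    rw [Real.dist_eq, sub_zero] at this
    exact (le_abs_self _).trans this.le
  obtain ⟨s, hs⟩ := hstab μ ν z R
  refine ⟨_, s, hs, ?_⟩
  filter_upwards [eventually_abs_polWindow_sub_truncated_le F m' M hM S emb ρ bV k hist μ ν z (R : ℝ) hC hCE hκ0.le hδ₀ hκ hv] with K hK
  refine hK.trans (le_trans (le_of_eq ?_) hRε)
  rw [hCst]; ring

include hM in
/-- ★★★ **W1-19b's EXISTENCE LETTER `PolLimitsExist F (localizedSum F S emb) ρ bV W` FROM TRUNCATION STABILITY + SOFT VALUE MAJORANTS** — for every coupling sequence `g` of the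
window `W` and every level `k`, the hypotheses of `polLimitExists_localizedSum_of_truncationStable` at `hist := histPrefix g k` (constants free to depend on `(g, k)`). This is the letter every
termwise road to node U3's kernel letters displays ((D4), N22, N18 — this seat's `kernelStepRate_localizedSum_of_softSum ∕ _of_holomorphicTwoRun`).
[cite: Balaban1987RG1, (1.7) p.261 and (1.21) p.264; Balaban1988RG2Cluster, (2.14) p.15] -/
theorem polLimitsExist_localizedSum_of_truncationStable (W : Set (ℕ → ℝ)) {κ δ₀ : ℝ} (hκ0 : 0 < κ) (hδ₀ : 0 < δ₀) (hκ : kappa₀ (4 * 2 ^ 4) (2 * 4) ≤ κ / 2 / 2)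
    (hC : ∀ g ∈ W, ∀ (k K : ℕ) (X : (domSys (F.P K) M (k + 1)).Dom), ContDiffAt ℝ 2 (expChart (fun W' => (((S K) k).E (histPrefix g k) (emb K k W') X).re) ρ) 0)
    (hval : ∀ g ∈ W, ∀ (k : ℕ) (μ ν : Fin 4) (z : Fin 4 → ℤ), ∃ CE : ℝ, 0 ≤ CE ∧ ∀ (K : ℕ) (X : (domSys (F.P K) M (k + 1)).Dom) (c : ι),
      let e : Site (F.P K) (k + 1) → TPt 4 (domCount (F.P K) M (k + 1) * M) := fun x i => (ZMod.cast (x i) : ZMod (domCount (F.P K) M (k + 1) * M))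
      |polComp ℝ (expChart (fun W' => (((S K) k).E (histPrefix g k) (emb K k W') X).re) ρ) bV (Fin.cast (F.P_d K).symm μ) (siteOfInt F K (k + 1) z) c
          (Fin.cast (F.P_d K).symm ν) (siteOfInt F K (k + 1) 0) c| ≤
        CE * Real.exp (-κ * torusTreeLen X.1) * Real.exp (-δ₀ * distCT (domCount (F.P K) M (k + 1)) M (e (siteOfInt F K (k + 1) z)) (nearT (M := M) (e (siteOfInt F K (k + 1) z)) X)) *
          Real.exp (-δ₀ * distCT (domCount (F.P K) M (k + 1)) M (e (siteOfInt F K (k + 1) 0)) (nearT (M := M) (e (siteOfInt F K (k + 1) 0)) X)))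
    (hstab : ∀ g ∈ W, ∀ (k : ℕ) (μ ν : Fin 4) (z : Fin 4 → ℤ) (R : ℕ), ∃ s : ℝ, Tendsto (fun K : ℕ =>
      ∑ X ∈ Finset.univ.filter (fun X : (domSys (F.P K) M (k + 1)).Dom => ¬ (R : ℝ) < torusTreeLen X.1),
        polScalar (fun W' => (((S K) k).E (histPrefix g k) (emb K k W') X).re) ρ bV (Fin.cast (F.P_d K).symm μ) (siteOfInt F K (k + 1) z) (Fin.cast (F.P_d K).symm ν)
          (siteOfInt F K (k + 1) 0)) atTop (𝓝 s)) :
    PolLimitsExist F (localizedSum F S emb) ρ bV W :=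
  fun g hg k => polLimitExists_localizedSum_of_truncationStable F m' M hM S emb ρ bV k (histPrefix g k) (hC g hg k) hκ0 hδ₀ hκ (hval g hg k) (hstab g hg k)

end Letter

/-! ## §4b AT THE RECORD, Stage 13: `PolLimitsExistOfRecord₁₃` under W1-20's law -/

section Record

open scoped Matrix.Norms.L2Operator

variable {𝔸 : Type*} (F : T4Family) (N : ℕ) [NeZero N] (m' : ℕ) (M : ℕ) [NeZero M] (hM : M = F.L ^ m')

include hM in
/-- ★★★ **THE (1.21) EXISTENCE LETTER OF RECORD `PolLimitsExistOfRecord₁₃ F N θ` FROM THE LOCALIZED REPRESENTATION**: under W1-20's law `Localizes17OfRecord₁₃ F N θ S emb` (the merged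
term family of record IS the reading's (1.7) sum), the terms' `C²` charts in the record's β-chart `θ.ρ8`, K-uniform soft value majorants at the colour directions `θ.bV c`, and the
convergence of every `R`-truncated window sum ⇒ the existence letter the three kernel roads display (def-W1's `polLimitsExistOfRecord₁₃_iff_of_localizes`).
[cite: Balaban1987RG1, (1.7) p.261 and (1.21) p.264; Balaban1988RG2Cluster, (2.14) p.15] -/
theorem polLimitsExistOfRecord₁₃_of_truncationStable (θ : Stage13Params F N) (S : (K : ℕ) → ClusterTower (F.P K) 𝔸 M) (emb : ReadingMaps F (MatA N) 𝔸)
    (hloc : Localizes17OfRecord₁₃ F N θ S emb) {κ δ₀ : ℝ} (hκ0 : 0 < κ) (hδ₀ : 0 < δ₀) (hκ : kappa₀ (4 * 2 ^ 4) (2 * 4) ≤ κ / 2 / 2)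
    (hC : letI := θ.instVβ₁; letI := θ.instVβ₂
      ∀ g ∈ Window θ.γ, ∀ (k K : ℕ) (X : (domSys (F.P K) M (k + 1)).Dom),
        ContDiffAt ℝ 2 (expChart (fun W' => (((S K) k).E (histPrefix g k) (emb K k W') X).re) θ.ρ8) 0)
    (hval : letI := θ.instVβ₁; letI := θ.instVβ₂; letI := θ.instιβ
      ∀ g ∈ Window θ.γ, ∀ (k : ℕ) (μ ν : Fin 4) (z : Fin 4 → ℤ), ∃ CE : ℝ, 0 ≤ CE ∧ ∀ (K : ℕ) (X : (domSys (F.P K) M (k + 1)).Dom) (c : θ.ιβ),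
        let e : Site (F.P K) (k + 1) → TPt 4 (domCount (F.P K) M (k + 1) * M) := fun x i => (ZMod.cast (x i) : ZMod (domCount (F.P K) M (k + 1) * M))
        |polComp ℝ (expChart (fun W' => (((S K) k).E (histPrefix g k) (emb K k W') X).re) θ.ρ8) θ.bV (Fin.cast (F.P_d K).symm μ) (siteOfInt F K (k + 1) z) c
            (Fin.cast (F.P_d K).symm ν) (siteOfInt F K (k + 1) 0) c| ≤
          CE * Real.exp (-κ * torusTreeLen X.1) * Real.exp (-δ₀ * distCT (domCount (F.P K) M (k + 1)) M (e (siteOfInt F K (k + 1) z)) (nearT (M := M) (e (siteOfInt F K (k + 1) z)) X)) *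
            Real.exp (-δ₀ * distCT (domCount (F.P K) M (k + 1)) M (e (siteOfInt F K (k + 1) 0)) (nearT (M := M) (e (siteOfInt F K (k + 1) 0)) X)))
    (hstab : letI := θ.instVβ₁; letI := θ.instVβ₂; letI := θ.instιβ
      ∀ g ∈ Window θ.γ, ∀ (k : ℕ) (μ ν : Fin 4) (z : Fin 4 → ℤ) (R : ℕ), ∃ s : ℝ, Tendsto (fun K : ℕ =>
        ∑ X ∈ Finset.univ.filter (fun X : (domSys (F.P K) M (k + 1)).Dom => ¬ (R : ℝ) < torusTreeLen X.1),
          polScalar (fun W' => (((S K) k).E (histPrefix g k) (emb K k W') X).re) θ.ρ8 θ.bV (Fin.cast (F.P_d K).symm μ) (siteOfInt F K (k + 1) z) (Fin.cast (F.P_d K).symm ν)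
            (siteOfInt F K (k + 1) 0)) atTop (𝓝 s)) :
    PolLimitsExistOfRecord₁₃ F N θ := by
  letI := θ.instVβ₁; letI := θ.instVβ₂; letI := θ.instιβ
  exact (polLimitsExistOfRecord₁₃_iff_of_localizes F N θ S emb hloc).2
    (polLimitsExist_localizedSum_of_truncationStable F m' M hM S emb θ.ρ8 θ.bV (Window θ.γ) hκ0 hδ₀ hκ hC hval hstab)

end Record

/-! ## §5 A6 smoke: the letter's road fires at the zero probe chart -/

section Smoke

variable {𝔄 : Type*} [NormedRing 𝔄] [NormedAlgebra ℝ 𝔄] {V : Type*} [NormedAddCommGroup V] [NormedSpace ℝ V] {ι : Type*} [Fintype ι]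
variable (F : T4Family)

/-- **A6 — THE EXISTENCE ROAD FIRES AT THE ZERO PROBE CHART** `ρ = 0`: every chart is constant (`C^∞`), every colour-diagonal kernel vanishes (`polTensor_const`) so the majorants hold
with `C_E := 0`, and every truncated sum is identically `0` (convergent) — `polLimitsExist_localizedSum_of_truncationStable` yields `PolLimitsExist F (localizedSum F S emb) 0 bV W` for
every `m′`, towers `S`, reading maps, basis and window (dag-n22-w3's `polLimitExists_zeroChart` re-derived THROUGH the road; numerics `κ := 4κ₀(64,8) + 4`, `δ₀ := 1`).  Degenerate, declared.
[cite: Balaban1987RG1, (1.21) p.264 (bookkeeping at `ρ = 0`)] -/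
theorem polLimitsExist_localizedSum_of_truncationStable_fires_zeroChart (m' : ℕ) {𝔸 : Type*} [NeZero (F.L ^ m')]
    (S : (K : ℕ) → ClusterTower (F.P K) 𝔸 (F.L ^ m')) (emb : ReadingMaps F 𝔄 𝔸) (bV : Module.Basis ι ℝ V) (W : Set (ℕ → ℝ)) :
    PolLimitsExist F (localizedSum F S emb) (0 : V →L[ℝ] 𝔄) bV W := by
  have hk0 : 0 ≤ kappa₀ (4 * 2 ^ 4) (2 * 4) := B12TreeDecay.kappa₀_nonneg (by norm_num) _
  refine polLimitsExist_localizedSum_of_truncationStable F m' (F.L ^ m') rfl S emb 0 bV W (κ := 4 * kappa₀ (4 * 2 ^ 4) (2 * 4) + 4) (δ₀ := 1)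
    (by linarith) one_pos (by linarith) (fun g _ k K X => by rw [expChart_zeroChart]; exact contDiffAt_const) ?_ ?_
  · intro g _ k μ ν z
    refine ⟨0, le_rfl, fun K X c => ?_⟩
    simp only [polComp, expChart_zeroChart, polTensor_const, abs_zero, zero_mul]
    exact le_rfl
  · intro g _ k μ ν z R
    refine ⟨0, ?_⟩
    have h0 : ∀ K, (∑ X ∈ Finset.univ.filter (fun X : (domSys (F.P K) (F.L ^ m') (k + 1)).Dom => ¬ (R : ℝ) < torusTreeLen X.1),
        polScalar (fun W' => (((S K) k).E (histPrefix g k) (emb K k W') X).re) (0 : V →L[ℝ] 𝔄) bV (Fin.cast (F.P_d K).symm μ) (siteOfInt F K (k + 1) z)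
          (Fin.cast (F.P_d K).symm ν) (siteOfInt F K (k + 1) 0)) = 0 := fun K =>
      Finset.sum_eq_zero fun X _ => polScalar_zeroChart _ bV _ _ _ _
    simp only [h0]
    exact tendsto_const_nhds

end Smoke

end YMDAG.N18.PolLimitsExistOfLocalTerms

end
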